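import Mathlib
import HarnessLib
import Summits.Ventures.LatticeQCDFlow.Scoring.HMCKernelSymmetry
import Summits.Ventures.LatticeQCDFlow.Scoring.CloverDensityMeanZero
import Literature.MathematicalPhysics.QuantumFieldTheory.PlaquetteWeightSiteRPConjugate

/-!
# The HMC kernel of arm E2 commutes with every lattice translation; one-point functions of the chain are homogeneous at every step from the cold and hot starts

HONEST FRAMING: exact (Metropolis-corrected) sampling algorithms for lattice gauge theory;
figures of merit are autocorrelation/cost numbers at stated couplings and volumes; no
continuum-physics claim.

Venture `LatticeQCDFlow` (cell pub-lqcd), sub-topic `Scoring`, FANOUT row 21 (`su3-base`, arm `E2 = PBC-HMC` on `SU(3)`; row 16's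
arm E2 on `SU(2)` is the same kernel).  NEW WORK of the cell: the TRANSLATION leg that row 16's `Scoring/HMCKernelSymmetry` lists as
"NOT here (same template with `transRegₗ`)" — gauge covariance and the time reflection `Θ'` are there.  Over row 16's
`KickDriftSymmetry` (`transPhase`, `mdWord_transPhase`, `mdHamiltonian_transPhase`, `wilsonMDAction_invariances`, `kinetic_transReg`),
`MomentumLawSymmetry` (`transRegₗ`, `coordMap`, `apply_momOf`, `measurePreserving_coordMap`, `coordMeasurableEquiv`),
`HMCKernelSymmetry` (`hmcStep`, `hmcNoise`, `hmcKernel`, `hmcKernel_apply`, `measurable_hmcStep_right`),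
`SymmetricSamplerOddObservables` (`map_bind_nHit_eq_self`), `CloverDensityMeanZero` (`torusConfigShift_eq_siteTranslate`), the
Literature torus translation `TorusTranslation.torusConfigShift v` (a measurable equivalence) and row 7's `conjKernel`.
Def-free; nothing is cited as a fact; no number.

## What is proved (every `d`, `L ≥ 1`, `n`, coupling `β`, MD step `ε`, kick–drift word `w`, basis `B`, translation vector `a`)

* §1 `energyChange_transPhase` (`ΔH_w` is invariant under the lifted translation for a translation-invariant action),
  **`hmcStep_siteTranslate`** — `hmcStep (τ_a U) (O_a c, u) = τ_a (hmcStep U (c, u))` with `O_a = coordMap (transRegₗ a)` the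
  relabelling of the momentum coefficients; `measurePreserving_noise_transReg` (the relabelled noise has the same law);
  **`hmcKernel_siteTranslate`** — `κ(τ_a U) = (τ_a)_* κ(U)`; **`conjKernel_hmcKernel_torusConfigShift`** — `conjKernel κ T_v = κ` for
  the Literature's measurable translation `T_v = torusConfigShift v` (`T_v U = τ_{−v} U`), every `v`.
* §2 translation-invariant starts stay translation invariant: `dirac_one_map_torusConfigShift` (cold start `U ≡ 1`),
  `piHaar_map_torusConfigShift` (hot start `∏ dHaar`), **`hmcChain_law_map_torusConfigShift`** — from any `T_v`-invariant initial
  law the `N`-step law `μ₀ κᴺ` is `T_v`-invariant for every `N`; hence **`integral_hmcChain_comp_torusConfigShift`**: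
  `∫ F(T_v U) d(μ₀κᴺ) = ∫ F d(μ₀κᴺ)` for every observable `F`, every `v`, `N` — ONE-POINT FUNCTIONS OF THE CHAIN ARE HOMOGENEOUS AT
  EVERY STEP (e.g. `⟨P_x⟩_N = ⟨P_y⟩_N`; `integral_hmcChain_plaquette_translate`: `⟨f(U_{x−v;ij})⟩_N = ⟨f(U_{x;ij})⟩_N`), thermalised or not;
  cold/hot corollaries `integral_hmcColdStart_comp_torusConfigShift`, `integral_hmcHotStart_comp_torusConfigShift`.
NOT CLAIMED: arm E1 (a fixed lexicographic heat-bath/overrelaxation sweep is not translation symmetric as an ordered product);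
stationarity of `κ`; axis permutations of the kernel (the momentum transport exists in the same way but is not typed here); numbers.
-/

noncomputable section

open Matrix MeasureTheory ProbabilityTheory ProbabilityTheory.Kernel
open Literature.MathematicalPhysics.QuantumFieldTheory
open Literature.MathematicalPhysics.QuantumFieldTheory.Luscher2010 (SuBasis)
open Literature.MathematicalPhysics.QuantumLattice (fundamentalRep continuous_fundamentalRep)
open Summit.Ventures.LatticeQCDFlow.Exactness (conjKernel conjKernel_apply nHit)

namespace Summit.Ventures.LatticeQCDFlow.Scoring

variable {d L n : ℕ}

/-! ## §1 The update intertwines the translations -/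

section Translation

variable [NeZero L] (B : SuBasis n) (β ε : ℝ) (w : List MDOp) (a : Site d L)

/-- `ΔH_w` is invariant under the lifted translation for every translation-invariant action. -/
theorem energyChange_transPhase {S : GaugeConfig d L (Matrix.specialUnitaryGroup (Fin n) ℂ) → ℝ}
    (hS : ∀ (v : Site d L) (U : GaugeConfig d L (Matrix.specialUnitaryGroup (Fin n) ℂ)), S (U.siteTranslate v) = S U)
    (z : MDPhase d L n) :
    mdHamiltonian S (mdWord ε w (transPhase a z)) - mdHamiltonian S (transPhase a z) =
      mdHamiltonian S (mdWord ε w z) - mdHamiltonian S z := by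
  rw [mdWord_transPhase, mdHamiltonian_transPhase hS, mdHamiltonian_transPhase hS]

/-- The engine's action `β·S_W` is translation invariant (Literature `wilsonAction_torusConfigShift`). -/
theorem wilsonMDAction_siteTranslate (v : Site d L) (U : GaugeConfig d L (Matrix.specialUnitaryGroup (Fin n) ℂ)) :
    β * wilsonAction (fundamentalRep (Fin n)) (U.siteTranslate v) = β * wilsonAction (fundamentalRep (Fin n)) U := by
  have h := wilsonAction_torusConfigShift (fundamentalRep (Fin n)) (-v) U
  rw [torusConfigShift_eq_siteTranslate, neg_neg] at h
  rw [h]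

/-- **The update intertwines the translation**: running the update from `τ_a U` with the RELABELLED momentum coefficients and the
same uniform gives the translation of the update from `U`: `hmcStep (τ_a U) (O_a c, u) = τ_a (hmcStep U (c, u))`. -/
theorem hmcStep_siteTranslate (U : GaugeConfig d L (Matrix.specialUnitaryGroup (Fin n) ℂ))
    (c : Edge d L × B.ι → ℝ) (u : ℝ) :
    hmcStep B β ε w (U.siteTranslate a) (coordMap B (transRegₗ a) c, u) = (hmcStep B β ε w U (c, u)).siteTranslate a := by
  have hmom : momOf B (coordMap B (transRegₗ a) c) = transReg a (momOf B c) := (apply_momOf B (transRegₗ a) c).symm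
  have hword : mdWord ε w (U.siteTranslate a, transReg a (momOf B c)) = transPhase a (mdWord ε w (U, momOf B c)) :=
    mdWord_transPhase a ε w (U, momOf B c)
  have hΔ : energyChange B β ε w (U.siteTranslate a) (coordMap B (transRegₗ a) c) = energyChange B β ε w U c := by
    unfold energyChange wilsonH
    rw [hmom]
    exact energyChange_transPhase ε w a (wilsonMDAction_siteTranslate β) (U, momOf B c)
  unfold hmcStep
  simp only [hΔ]
  split_ifs with h
  · rw [hmom, hword]
    rfl
  · rfl

/-- The relabelling of the noise `(c, u) ↦ (O_a c, u)` preserves its law. -/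
theorem measurePreserving_noise_transReg :
    MeasurePreserving (Prod.map (coordMeasurableEquiv B (transRegₗ a) (kinetic_transReg a)) id)
      (hmcNoise B (d := d) (L := L)) (hmcNoise B) :=
  (measurePreserving_coordMap B (transRegₗ a) (kinetic_transReg a)).prod (MeasurePreserving.id _)

omit [NeZero L] in
/-- Lattice translation of configurations is measurable. -/
theorem measurable_siteTranslate :
    Measurable (fun U : GaugeConfig d L (Matrix.specialUnitaryGroup (Fin n) ℂ) => U.siteTranslate a) :=
  measurable_pi_lambda _ fun _ => measurable_pi_apply _

/-- **THE HMC KERNEL COMMUTES WITH EVERY LATTICE TRANSLATION**: `κ(τ_a U) = (τ_a)_* κ(U)`. -/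
theorem hmcKernel_siteTranslate (U : GaugeConfig d L (Matrix.specialUnitaryGroup (Fin n) ℂ)) :
    hmcKernel B β ε w (U.siteTranslate a) =
      (hmcKernel B β ε w U).map (fun V : GaugeConfig d L (Matrix.specialUnitaryGroup (Fin n) ℂ) => V.siteTranslate a) := by
  rw [hmcKernel_apply, hmcKernel_apply]
  have hT := measurePreserving_noise_transReg B a (d := d) (L := L)
  have hmeasT : Measurable (Prod.map (coordMeasurableEquiv B (transRegₗ a) (kinetic_transReg a)) id :
      ((Edge d L × B.ι → ℝ) × ℝ) → (Edge d L × B.ι → ℝ) × ℝ) := hT.measurable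
  have hfun : hmcStep B β ε w (U.siteTranslate a) ∘ Prod.map (coordMeasurableEquiv B (transRegₗ a) (kinetic_transReg a)) id =
      (fun V : GaugeConfig d L (Matrix.specialUnitaryGroup (Fin n) ℂ) => V.siteTranslate a) ∘ hmcStep B β ε w U := by
    funext r
    obtain ⟨c, u⟩ := r
    simp only [Function.comp_apply, Prod.map_apply, id_eq, coordMeasurableEquiv_apply]
    exact hmcStep_siteTranslate B β ε w a U c u
  calc (hmcNoise B).map (hmcStep B β ε w (U.siteTranslate a))
      = ((hmcNoise B).map (Prod.map (coordMeasurableEquiv B (transRegₗ a) (kinetic_transReg a)) id)).map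
          (hmcStep B β ε w (U.siteTranslate a)) := by rw [hT.map_eq]
    _ = (hmcNoise B).map (hmcStep B β ε w (U.siteTranslate a) ∘
          Prod.map (coordMeasurableEquiv B (transRegₗ a) (kinetic_transReg a)) id) :=
        Measure.map_map (measurable_hmcStep_right B β ε w _) hmeasT
    _ = (hmcNoise B).map ((fun V : GaugeConfig d L (Matrix.specialUnitaryGroup (Fin n) ℂ) => V.siteTranslate a) ∘
          hmcStep B β ε w U) := by rw [hfun]
    _ = ((hmcNoise B).map (hmcStep B β ε w U)).map (fun V => V.siteTranslate a) :=
        (Measure.map_map (measurable_siteTranslate a) (measurable_hmcStep_right B β ε w U)).symm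

omit [NeZero L] in
/-- The inverse of the Literature translation `T_v` is `τ_v`: `(torusConfigShift v)⁻¹ U = U.siteTranslate v`. -/
theorem torusConfigShift_symm_apply (v : Site d L) (U : GaugeConfig d L (Matrix.specialUnitaryGroup (Fin n) ℂ)) :
    (TorusTranslation.torusConfigShift v).symm U = U.siteTranslate v := by
  funext e
  rfl

omit [NeZero L] in
/-- `T_v (τ_v U) = U`. -/
theorem torusConfigShift_siteTranslate (v : Site d L) (U : GaugeConfig d L (Matrix.specialUnitaryGroup (Fin n) ℂ)) :
    TorusTranslation.torusConfigShift v (U.siteTranslate v) = U := by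
  rw [← torusConfigShift_symm_apply, MeasurableEquiv.apply_symm_apply]

/-- **`conjKernel κ T_v = κ`** for the Literature's measurable translation `T_v = torusConfigShift v`, every `v` — the form consumed by
`SymmetricSamplerOddObservables` and `KernelSymmetryOddObservables`. -/
theorem conjKernel_hmcKernel_torusConfigShift (v : Site d L) :
    conjKernel (hmcKernel B β ε w) (TorusTranslation.torusConfigShift (G := Matrix.specialUnitaryGroup (Fin n) ℂ) v) =
      hmcKernel B β ε w := by
  refine ProbabilityTheory.Kernel.ext fun U => ?_
  rw [conjKernel_apply, torusConfigShift_symm_apply, hmcKernel_siteTranslate,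
    Measure.map_map (TorusTranslation.torusConfigShift v).measurable (measurable_siteTranslate v)]
  have hid : ((TorusTranslation.torusConfigShift (G := Matrix.specialUnitaryGroup (Fin n) ℂ) v) ∘
      fun V : GaugeConfig d L (Matrix.specialUnitaryGroup (Fin n) ℂ) => V.siteTranslate v) = id :=
    funext fun V => torusConfigShift_siteTranslate v V
  rw [hid, Measure.map_id]

end Translation

/-! ## §2 Translation-invariant starts: one-point functions of the chain are homogeneous at every step -/

section Starts

variable [NeZero L] (B : SuBasis n) (β ε : ℝ) (w : List MDOp)

omit [NeZero L] in
/-- The cold start `U ≡ 1` is translation fixed. -/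
theorem torusConfigShift_one (v : Site d L) :
    TorusTranslation.torusConfigShift v (1 : GaugeConfig d L (Matrix.specialUnitaryGroup (Fin n) ℂ)) = 1 := by
  funext e
  rw [TorusTranslation.torusConfigShift_apply]
  rfl

omit [NeZero L] in
/-- The cold-start law `δ_{U ≡ 1}` is translation invariant. -/
theorem dirac_one_map_torusConfigShift (v : Site d L) :
    (Measure.dirac (1 : GaugeConfig d L (Matrix.specialUnitaryGroup (Fin n) ℂ))).map (TorusTranslation.torusConfigShift v) =
      Measure.dirac 1 := by
  rw [Measure.map_dirac' (TorusTranslation.torusConfigShift v).measurable, torusConfigShift_one]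

/-- The hot-start law `∏ₑ dHaar(U_e)` is translation invariant (the Literature's `WeightSiteRP.measurePreserving_torusConfigShift`). -/
theorem piHaar_map_torusConfigShift (v : Site d L) :
    (Measure.pi fun _ : Edge d L => haarProbability (Matrix.specialUnitaryGroup (Fin n) ℂ)).map
        (TorusTranslation.torusConfigShift v) =
      Measure.pi fun _ : Edge d L => haarProbability (Matrix.specialUnitaryGroup (Fin n) ℂ) :=
  (WeightSiteRP.measurePreserving_torusConfigShift (G := Matrix.specialUnitaryGroup (Fin n) ℂ) v).map_eq

/-- **From any translation-invariant start the `N`-step law of the HMC chain is translation invariant**, every `N`. -/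
theorem hmcChain_law_map_torusConfigShift {μ₀ : Measure (GaugeConfig d L (Matrix.specialUnitaryGroup (Fin n) ℂ))}
    (v : Site d L) (hμ₀ : μ₀.map (TorusTranslation.torusConfigShift v) = μ₀) (N : ℕ) :
    (μ₀.bind (nHit (hmcKernel B β ε w) N)).map (TorusTranslation.torusConfigShift v) = μ₀.bind (nHit (hmcKernel B β ε w) N) :=
  map_bind_nHit_eq_self (conjKernel_hmcKernel_torusConfigShift B β ε w v) hμ₀ N

/-- **ONE-POINT FUNCTIONS OF THE CHAIN ARE HOMOGENEOUS AT EVERY STEP**: `∫ F(T_v U) d(μ₀κᴺ) = ∫ F d(μ₀κᴺ)` for every observable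
`F`, every translation `v` and every `N`, from any translation-invariant start. -/
theorem integral_hmcChain_comp_torusConfigShift {μ₀ : Measure (GaugeConfig d L (Matrix.specialUnitaryGroup (Fin n) ℂ))}
    (v : Site d L) (hμ₀ : μ₀.map (TorusTranslation.torusConfigShift v) = μ₀) (N : ℕ) {E : Type*} [NormedAddCommGroup E]
    [NormedSpace ℝ E] (F : GaugeConfig d L (Matrix.specialUnitaryGroup (Fin n) ℂ) → E) :
    ∫ U, F (TorusTranslation.torusConfigShift v U) ∂(μ₀.bind (nHit (hmcKernel B β ε w) N)) =
      ∫ U, F U ∂(μ₀.bind (nHit (hmcKernel B β ε w) N)) :=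
  (MeasurePreserving.mk (TorusTranslation.torusConfigShift v).measurable
    (hmcChain_law_map_torusConfigShift B β ε w v hμ₀ N)).integral_comp' F


/-- **Plaquette one-point functions of the chain are homogeneous**: at every step `N`, from any translation-invariant start,
`⟨f(U_{x − v; ij})⟩_N = ⟨f(U_{x;ij})⟩_N` for every function `f` of one plaquette holonomy and every `v` (the lattice-averaged
plaquette of the run check averages identically distributed terms). -/
theorem integral_hmcChain_plaquette_translate {μ₀ : Measure (GaugeConfig d L (Matrix.specialUnitaryGroup (Fin n) ℂ))}
    (v : Site d L) (hμ₀ : μ₀.map (TorusTranslation.torusConfigShift v) = μ₀) (N : ℕ) {E : Type*} [NormedAddCommGroup E]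
    [NormedSpace ℝ E] (f : Matrix.specialUnitaryGroup (Fin n) ℂ → E) (x : Site d L) (i j : Fin d) :
    ∫ U, f (plaquetteHolonomy U (x - v) i j) ∂(μ₀.bind (nHit (hmcKernel B β ε w) N)) =
      ∫ U, f (plaquetteHolonomy U x i j) ∂(μ₀.bind (nHit (hmcKernel B β ε w) N)) := by
  have h := integral_hmcChain_comp_torusConfigShift B β ε w v hμ₀ N (fun U => f (plaquetteHolonomy U x i j))
  simp only [torusConfigShift_eq_siteTranslate, plaquetteHolonomy_siteTranslate, ← sub_eq_add_neg] at h
  exact h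

/-- **Cold start**: `∫ F(T_v U) d(δ₁κᴺ) = ∫ F d(δ₁κᴺ)`, every `F`, `v`, `N`. -/
theorem integral_hmcColdStart_comp_torusConfigShift (v : Site d L) (N : ℕ) {E : Type*} [NormedAddCommGroup E]
    [NormedSpace ℝ E] (F : GaugeConfig d L (Matrix.specialUnitaryGroup (Fin n) ℂ) → E) :
    ∫ U, F (TorusTranslation.torusConfigShift v U) ∂((Measure.dirac 1).bind (nHit (hmcKernel B β ε w) N)) =
      ∫ U, F U ∂((Measure.dirac 1).bind (nHit (hmcKernel B β ε w) N)) :=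
  integral_hmcChain_comp_torusConfigShift B β ε w v (dirac_one_map_torusConfigShift v) N F

/-- **Hot start**: `∫ F(T_v U) d((∏ dHaar)κᴺ) = ∫ F d((∏ dHaar)κᴺ)`, every `F`, `v`, `N`. -/
theorem integral_hmcHotStart_comp_torusConfigShift (v : Site d L) (N : ℕ) {E : Type*} [NormedAddCommGroup E]
    [NormedSpace ℝ E] (F : GaugeConfig d L (Matrix.specialUnitaryGroup (Fin n) ℂ) → E) :
    ∫ U, F (TorusTranslation.torusConfigShift v U)
        ∂((Measure.pi fun _ : Edge d L => haarProbability (Matrix.specialUnitaryGroup (Fin n) ℂ)).bind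
          (nHit (hmcKernel B β ε w) N)) =
      ∫ U, F U ∂((Measure.pi fun _ : Edge d L => haarProbability (Matrix.specialUnitaryGroup (Fin n) ℂ)).bind
          (nHit (hmcKernel B β ε w) N)) :=
  integral_hmcChain_comp_torusConfigShift B β ε w v (piHaar_map_torusConfigShift v) N F

end Starts

end Summit.Ventures.LatticeQCDFlow.Scoring
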